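/-
Copyright (c) 2026 the pub-hodgecm-mathlib formalisation cell (harness21).  Prover seat hodgecm-mathlib-F0P2-p06 (g8), programme P2,
road Θ-OCC-GEN (desk F0P2-plan, sub-line OCC♭-GEN), brick (N1) «L²-CONTINUITY AND `hcoef` AT THE LINE'S `μ`-SPLITTING», 2026-09-01.
KERNEL module: THEOREMS ONLY (no definition, no named fact, no `sorry`, no instance, no notation).
-/
import Literature.NumberTheory.Li1992.RallisCoeffContinuousCM
import Literature.NumberTheory.Automorphic.Liu2021.ThetaLiftFromLineMajorants
import Literature.NumberTheory.Automorphic.Liu2021.Def411WeilCarriersDoubling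
import Literature.NumberTheory.Automorphic.Liu2021.Def411WeilCarriers
import Literature.NumberTheory.Automorphic.IdeleClassCharacterHecke
import Literature.NumberTheory.GelbartRogawski1991.UnitaryDualPairThetaKernel
import Literature.RepresentationTheory.Liu2021.OscillatorConventions
import HarnessLib

/-!
# [Weil1964, n° 41 Lemme 5; Li1992, (25) p. 184] `L²`-continuity of the Weil representation of `U(diag d_V) × U(⟨a⟩)` along the LINE splitting of
# [Liu2021, App. D Steps 1–2], and the binder `hcoef` of Rallis' letter — at the T5 spelling `T_W a = !![a]`

Topic `NumberTheory/Automorphic/Liu2021`; namespace `Literature.NumberTheory.Automorphic.Liu2021`.  THEOREMS ONLY.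
Cell hodgecm-mathlib FLOOR 0, programme P2, the Θ-OCC-GEN road (books #173).  Companion of `ThetaLiftFromLineMajorants` (brick (N0), same device):
★ `Weil1964.continuous_toL2_omega_pairSplitting_canonical` is generic in the compatible CONTINUOUS splitting `s` but stated for diagonal real Gram data;
we state it for a VARIABLE `T_W` with `T_W = realDiagonal L d_W _` and `subst`, then read it at `T_W a` (★ `TW_eq_realDiagonal`, brick (N0)).  The coefficient
continuity `hcoef` of ★ `Li1992.RallisInnerProductFormulaUnitaryDualPairRankOneContCM` — `h ↦ ⟨ω(s_pair(1,h))Φ₁, Φ₂⟩_{ν_X}` continuous on `U(J_W)(𝔸_{L⁺})`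
— follows by ★ `Li1992.continuous_schwartzPairing_of_continuous_toLp` at the class map ★ `piSchwartzBruhatToLp`.

* `continuous_toLp_pairRep_line_of_signs` — ANY compatible continuous `s` of the line datum, variable `T_W = realDiagonal d_W`: every orbit map
  `(u₁, u₂) ↦ i (ω(s_pair(u₁,u₂)) Φ)` is continuous in `L²(𝔸ⁿ, ν)` (sign facts `(ι₁, h₁V, hV)` on `d_V`; the line's own are automatic).
* `continuous_schwartzPairing_pairRep_line_of_signs` — `(u₁,u₂) ↦ ⟨ω(s_pair(u₁,u₂))Φ₁, Φ₂⟩_ν` continuous; `…_one_…` — the `hcoef` shape `h ↦ ⟨ω(s_pair(1,h))Φ₁, Φ₂⟩_ν`.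
* **`continuous_schwartzPairing_pairRep_chiSplittingLine_TW_one`** — `hcoef` VERBATIM for `s := chiSplittingLine … χ … (T_W a) … (J_W a) (JW_eq …)`, every
  unitary splitting character `χ`; **`continuous_schwartzPairing_lineThetaKernelDatum_one`** — at `χ := toHeckeCharacter L μ` (the `hcoef` row of Rallis' letter
  for ★ `lineThetaKernelDatum L N e₁ dV hdV hdV0 μ hμ a hρ`); and the `L²`-orbit continuity `continuous_toLp_pairRep_lineThetaKernelDatum`.

HONEST LABEL: HC_CM is proved only modulo the 2 remaining named inputs (hLiu418, h413) until rung 0 closes; nothing of print is asserted here.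

## References
* [Weil1964] A. Weil, Acta Math. 111 (1964), Chap. III n° 41 Lemme 5 p. 194, n° 39 p. 189.
* [Li1992] J.-S. Li, J. reine angew. Math. 428 (1992), (25)–(26) p. 184, p. 178.
* [GelbartRogawski1991] S. Gelbart, J. Rogawski, Invent. Math. 105 (1991), §3.1 Prop. 3.1.1 p. 455.
* [Liu2021] Y. Liu, Camb. J. Math. 9 (2021) = arXiv:2102.11518, App. D §D.1 Steps 1–2 (l. 5215–5219).
-/

set_option autoImplicit false

noncomputable section

open NumberField NumberField.InfinitePlace IsDedekindDomain MeasureTheory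
open scoped Matrix

namespace Literature.NumberTheory.Automorphic.Liu2021

open Literature.NumberTheory.Automorphic Literature.NumberTheory.Automorphic.UnitaryGroup
open Literature.NumberTheory.Automorphic.IdeleClassGroup
open Literature.NumberTheory.Automorphic.Liu2021.Def411WeilCarriers
open Literature.NumberTheory.Automorphic.Liu2021.Def411WeilCarriersDoubling
open Literature.NumberTheory.GelbartRogawski1991 Literature.NumberTheory.GelbartRogawski1991.UnitaryDualPair
open Literature.NumberTheory.Weil1964 Literature.NumberTheory.Li1992
open Literature.NumberTheory.GaloisRepresentations (HeckeCharacter)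
open Literature.RepresentationTheory.HarrisKudlaSweet1996 (IsSplittingChar)
open Literature.RepresentationTheory.Liu2021

variable (L : Type) [Field L] [NumberField L] [IsCMField L] {N n' : ℕ} (e₁ : Fin N × Fin 1 ≃ Fin n')
  (dV : Fin N → L) (hdV : ∀ i, IsCMField.complexConj L (dV i) = dV i) (hdV0 : ∀ i, dV i ≠ 0)

/-! ## §0 Sign facts of a line (the two spellings of the line's Gram matrix: ★ `TW_eq_realDiagonal` of brick (N0)) -/

/-- a conjugation-fixed non-zero element of the CM field has a strict sign through every complex embedding. [folklore] -/
private theorem re_apply_pos_or_neg' (τ : L →+* ℂ) {x : L} (hx : IsCMField.complexConj L x = x) (hx0 : x ≠ 0) :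
    0 < (τ x).re ∨ (τ x).re < 0 :=
  (lt_or_gt_of_ne (re_apply_ne_zero_of_complexConj_eq L τ hx hx0)).symm

/-- for a LINE `⟨d_W⟩` the sign hypotheses are automatic through every complex embedding. [folklore] -/
private theorem re_apply_line_pos_or_neg' (τ : L →+* ℂ) (dW : Fin 1 → L) (hdW : ∀ i, IsCMField.complexConj L (dW i) = dW i)
    (hdW0 : ∀ i, dW i ≠ 0) : (∀ j, 0 < (τ (dW j)).re) ∨ ∀ j, (τ (dW j)).re < 0 :=
  (re_apply_pos_or_neg' L τ (hdW 0) (hdW0 0)).imp (fun h j => by rwa [Subsingleton.elim j 0])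
    fun h j => by rwa [Subsingleton.elim j 0]

variable [MeasurableSpace (AdeleRing (𝓞 ↥(maximalRealSubfield L)) ↥(maximalRealSubfield L))]
  [BorelSpace (AdeleRing (𝓞 ↥(maximalRealSubfield L)) ↥(maximalRealSubfield L))]
  (ν : Measure (Fin n' → AdeleRing (𝓞 ↥(maximalRealSubfield L)) ↥(maximalRealSubfield L))) [ν.IsAddHaarMeasure]

/-! ## §1 Any compatible continuous splitting of the line datum, Gram matrix `T_W = realDiagonal d_W` as a VARIABLE -/

set_option maxHeartbeats 1600000 in
-- heartbeats: the `subst` runs through the `splittingDatum` telescope of the line datum.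
/-- **`L²`-continuity of `ω_ψ ∘ s_pair` for ANY compatible continuous splitting of the line datum `(U(diag d_V), U(J_W))`**, any spelling
`T_W = realDiagonal d_W` of the line's real Gram matrix, any class map `i : 𝒮 → L²(ν)`: the orbit maps `(u₁, u₂) ↦ i (ω(s_pair(u₁,u₂)) Φ)`
are continuous (★ `Weil1964.continuous_toL2_omega_pairSplitting_canonical` after `subst`, frames `cmSignConv`, kinds ★ `nonempty_anyLeviKAKInput_cmSignConv`).
[cite: Weil1964, Chap. III n° 41 Lemme 5 p. 194, n° 39 p. 189] [cite: GelbartRogawski1991, §3.1 Prop. 3.1.1 p. 455] -/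
theorem continuous_toLp_pairRep_line_of_signs (dW : Fin 1 → L) (hdW : ∀ i, IsCMField.complexConj L (dW i) = dW i)
    (hdW0 : ∀ i, dW i ≠ 0) (TW : Matrix (Fin 1) (Fin 1) ↥(maximalRealSubfield L)) (hTW : TW = realDiagonal L dW hdW)
    (hW : TW.IsSymm) (hWd : IsUnit TW.det) (JW : Matrix (Fin 1) (Fin 1) L)
    (hJW : JW = TW.map (algebraMap (↥(maximalRealSubfield L)) L))
    {s : UnitaryGroup.adelicPair (↥(maximalRealSubfield L)) L (IsCMField.complexConj L) N 1 (Matrix.diagonal dV) JW →*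
      adelicMpCont (↥(maximalRealSubfield L)) (Fin n') (adelicGram (↥(maximalRealSubfield L)) e₁ (realDiagonal L dV hdV) TW)}
    (hs : (splittingDatum (↥(maximalRealSubfield L)) L (IsCMField.complexConj L) N 1 e₁ (Matrix.diagonal dV) JW
      (complexConj_imagUnit L) (imagUnit_ne_zero L) (imagUnit_mul_self L) (realDiagonal_isSymm L dV hdV) hW
      (isUnit_det_realDiagonal L dV hdV hdV0) hWd (realDiagonal_map L dV hdV).symm hJW).IsCompatible s)
    (hsc : Continuous s)
    (i : piSchwartzBruhat (↥(maximalRealSubfield L)) (Fin n') →ₗ[ℂ] Lp ℂ 2 ν)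
    (hi : ∀ Φ : piSchwartzBruhat (↥(maximalRealSubfield L)) (Fin n'),
      ((i Φ : Lp ℂ 2 ν) : (Fin n' → AdeleRing (𝓞 ↥(maximalRealSubfield L)) ↥(maximalRealSubfield L)) → ℂ) =ᵐ[ν]
        (Φ : (Fin n' → AdeleRing (𝓞 ↥(maximalRealSubfield L)) ↥(maximalRealSubfield L)) → ℂ))
    (ι₁ : L →+* ℂ)
    (h₁V : ∃ i₀ : Fin N, (∀ i, i ≠ i₀ → 0 < (ι₁ (dV i)).re) ∨ ∀ i, i ≠ i₀ → (ι₁ (dV i)).re < 0)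
    (hV : ∀ τ : L →+* ℂ, InfinitePlace.mk τ ≠ InfinitePlace.mk ι₁ → (∀ i, 0 < (τ (dV i)).re) ∨ ∀ i, (τ (dV i)).re < 0)
    (Φ : piSchwartzBruhat (↥(maximalRealSubfield L)) (Fin n')) :
    Continuous fun
      (p : ↥(UnitaryGroup.adelic (↥(maximalRealSubfield L)) L (IsCMField.complexConj L) N (Matrix.diagonal dV)) ×
        ↥(UnitaryGroup.adelic (↥(maximalRealSubfield L)) L (IsCMField.complexConj L) 1 JW)) =>
      i (pairRep (↥(maximalRealSubfield L)) L (IsCMField.complexConj L) N 1 e₁ (Matrix.diagonal dV) JW s p Φ) := by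
  subst hTW
  exact continuous_toL2_omega_pairSplitting_canonical L (IsCMField.complexConj L) N 1 e₁ (cmRealVec L dV hdV) (cmRealVec L dW hdW)
    (realDiagonal_map L dV hdV).symm hJW (complexConj_imagUnit L) (imagUnit_ne_zero L) (imagUnit_mul_self L)
    (realDiagonal_isSymm L dV hdV) hW ν i hi (IsCMField.complexConj_ne_one L) (cmPlaceOver L) (cmPlaceOver_smul L) (cmPlaceOver_comap L)
    (cmSignConv L dV ι₁) (cmSignConv_ne_zero L dV ι₁) (isUnit_det_realDiagonal L dV hdV hdV0) hWd
    (nonempty_anyLeviKAKInput_cmSignConv L dV hdV dW hdW ι₁ h₁V (re_apply_line_pos_or_neg' L ι₁ dW hdW hdW0) hV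
      fun _ _ => Or.inl ⟨0, fun j hj => absurd (Subsingleton.elim j 0) hj⟩)
    hs hsc Φ

set_option maxHeartbeats 1600000 in
/-- **matrix coefficients `(u₁, u₂) ↦ ⟨ω(s_pair(u₁,u₂))Φ₁, Φ₂⟩_ν` are continuous** for ANY compatible continuous splitting of the line datum (any
spelling `T_W = realDiagonal d_W`), by `continuous_toLp_pairRep_line_of_signs` at the class map ★ `piSchwartzBruhatToLp` and ★
`Li1992.continuous_schwartzPairing_of_continuous_toLp`. [cite: Weil1964, Chap. III n° 41 Lemme 5 p. 194] [cite: Li1992, p. 178 and (25) p. 184] -/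
theorem continuous_schwartzPairing_pairRep_line_of_signs (dW : Fin 1 → L) (hdW : ∀ i, IsCMField.complexConj L (dW i) = dW i)
    (hdW0 : ∀ i, dW i ≠ 0) (TW : Matrix (Fin 1) (Fin 1) ↥(maximalRealSubfield L)) (hTW : TW = realDiagonal L dW hdW)
    (hW : TW.IsSymm) (hWd : IsUnit TW.det) (JW : Matrix (Fin 1) (Fin 1) L)
    (hJW : JW = TW.map (algebraMap (↥(maximalRealSubfield L)) L))
    {s : UnitaryGroup.adelicPair (↥(maximalRealSubfield L)) L (IsCMField.complexConj L) N 1 (Matrix.diagonal dV) JW →*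
      adelicMpCont (↥(maximalRealSubfield L)) (Fin n') (adelicGram (↥(maximalRealSubfield L)) e₁ (realDiagonal L dV hdV) TW)}
    (hs : (splittingDatum (↥(maximalRealSubfield L)) L (IsCMField.complexConj L) N 1 e₁ (Matrix.diagonal dV) JW
      (complexConj_imagUnit L) (imagUnit_ne_zero L) (imagUnit_mul_self L) (realDiagonal_isSymm L dV hdV) hW
      (isUnit_det_realDiagonal L dV hdV hdV0) hWd (realDiagonal_map L dV hdV).symm hJW).IsCompatible s)
    (hsc : Continuous s) (ι₁ : L →+* ℂ)
    (h₁V : ∃ i₀ : Fin N, (∀ i, i ≠ i₀ → 0 < (ι₁ (dV i)).re) ∨ ∀ i, i ≠ i₀ → (ι₁ (dV i)).re < 0)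
    (hV : ∀ τ : L →+* ℂ, InfinitePlace.mk τ ≠ InfinitePlace.mk ι₁ → (∀ i, 0 < (τ (dV i)).re) ∨ ∀ i, (τ (dV i)).re < 0)
    (Φ₁ Φ₂ : piSchwartzBruhat (↥(maximalRealSubfield L)) (Fin n')) :
    Continuous fun
      (p : ↥(UnitaryGroup.adelic (↥(maximalRealSubfield L)) L (IsCMField.complexConj L) N (Matrix.diagonal dV)) ×
        ↥(UnitaryGroup.adelic (↥(maximalRealSubfield L)) L (IsCMField.complexConj L) 1 JW)) =>
      schwartzPairing (↥(maximalRealSubfield L)) (Fin n') ν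
        (pairRep (↥(maximalRealSubfield L)) L (IsCMField.complexConj L) N 1 e₁ (Matrix.diagonal dV) JW s p Φ₁) Φ₂ :=
  continuous_schwartzPairing_of_continuous_toLp (↥(maximalRealSubfield L)) (Fin n') ν
    (piSchwartzBruhatToLp (↥(maximalRealSubfield L)) (Fin n') ν) (coeFn_piSchwartzBruhatToLp ν)
    (fun p => pairRep (↥(maximalRealSubfield L)) L (IsCMField.complexConj L) N 1 e₁ (Matrix.diagonal dV) JW s p Φ₁)
    (continuous_toLp_pairRep_line_of_signs L e₁ dV hdV hdV0 ν dW hdW hdW0 TW hTW hW hWd JW hJW hs hsc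
      (piSchwartzBruhatToLp (↥(maximalRealSubfield L)) (Fin n') ν) (coeFn_piSchwartzBruhatToLp ν) ι₁ h₁V hV Φ₁) Φ₂

set_option maxHeartbeats 1600000 in
/-- **`hcoef` shape — `h ↦ ⟨ω(s_pair(1,h))Φ₁, Φ₂⟩_ν` is continuous on `U(J_W)(𝔸_{L⁺})`** for ANY compatible continuous splitting of the line datum.
[cite: Weil1964, Chap. III n° 41 Lemme 5 p. 194] [cite: Li1992, (25)–(26) p. 184] -/
theorem continuous_schwartzPairing_pairRep_line_one_of_signs (dW : Fin 1 → L) (hdW : ∀ i, IsCMField.complexConj L (dW i) = dW i)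
    (hdW0 : ∀ i, dW i ≠ 0) (TW : Matrix (Fin 1) (Fin 1) ↥(maximalRealSubfield L)) (hTW : TW = realDiagonal L dW hdW)
    (hW : TW.IsSymm) (hWd : IsUnit TW.det) (JW : Matrix (Fin 1) (Fin 1) L)
    (hJW : JW = TW.map (algebraMap (↥(maximalRealSubfield L)) L))
    {s : UnitaryGroup.adelicPair (↥(maximalRealSubfield L)) L (IsCMField.complexConj L) N 1 (Matrix.diagonal dV) JW →*
      adelicMpCont (↥(maximalRealSubfield L)) (Fin n') (adelicGram (↥(maximalRealSubfield L)) e₁ (realDiagonal L dV hdV) TW)}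
    (hs : (splittingDatum (↥(maximalRealSubfield L)) L (IsCMField.complexConj L) N 1 e₁ (Matrix.diagonal dV) JW
      (complexConj_imagUnit L) (imagUnit_ne_zero L) (imagUnit_mul_self L) (realDiagonal_isSymm L dV hdV) hW
      (isUnit_det_realDiagonal L dV hdV hdV0) hWd (realDiagonal_map L dV hdV).symm hJW).IsCompatible s)
    (hsc : Continuous s) (ι₁ : L →+* ℂ)
    (h₁V : ∃ i₀ : Fin N, (∀ i, i ≠ i₀ → 0 < (ι₁ (dV i)).re) ∨ ∀ i, i ≠ i₀ → (ι₁ (dV i)).re < 0)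
    (hV : ∀ τ : L →+* ℂ, InfinitePlace.mk τ ≠ InfinitePlace.mk ι₁ → (∀ i, 0 < (τ (dV i)).re) ∨ ∀ i, (τ (dV i)).re < 0)
    (Φ₁ Φ₂ : piSchwartzBruhat (↥(maximalRealSubfield L)) (Fin n')) :
    Continuous fun h : ↥(UnitaryGroup.adelic (↥(maximalRealSubfield L)) L (IsCMField.complexConj L) 1 JW) =>
      schwartzPairing (↥(maximalRealSubfield L)) (Fin n') ν
        (pairRep (↥(maximalRealSubfield L)) L (IsCMField.complexConj L) N 1 e₁ (Matrix.diagonal dV) JW s (1, h) Φ₁) Φ₂ :=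
  (continuous_schwartzPairing_pairRep_line_of_signs L e₁ dV hdV hdV0 ν dW hdW hdW0 TW hTW hW hWd JW hJW hs hsc ι₁ h₁V hV Φ₁ Φ₂).comp
    (Continuous.prodMk continuous_const continuous_id)

/-! ## §2 The T5 spelling: Gram `T_W a = !![a]`, form `J_W a`, `hJW := JW_eq` -/

set_option maxHeartbeats 1600000 in
/-- **`hcoef` AT THE LINE'S `χ`-SPLITTING, T5 SPELLING** — `h ↦ ⟨ω(s_χ(1,h))Φ₁, Φ₂⟩_ν` is continuous on `U(J_W a)(𝔸_{L⁺})` for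
`s_χ := chiSplittingLine … χ … (T_W a) … (J_W a) (JW_eq …)`, every unitary splitting character `χ`, from `(ι₁, h₁V, hV)`.
[cite: Weil1964, Chap. III n° 41 Lemme 5 p. 194] [cite: Li1992, (25)–(26) p. 184] [cite: Liu2021, App. D §D.1 Steps 1–2 (l. 5215–5219)] -/
theorem continuous_schwartzPairing_pairRep_chiSplittingLine_TW_one (χ : HeckeCharacter L) (hχu : χ.IsUnitary) (hχs : IsSplittingChar L 1 χ)
    (a : (↥(maximalRealSubfield L))ˣ) (ι₁ : L →+* ℂ)
    (h₁V : ∃ i₀ : Fin N, (∀ i, i ≠ i₀ → 0 < (ι₁ (dV i)).re) ∨ ∀ i, i ≠ i₀ → (ι₁ (dV i)).re < 0)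
    (hV : ∀ τ : L →+* ℂ, InfinitePlace.mk τ ≠ InfinitePlace.mk ι₁ → (∀ i, 0 < (τ (dV i)).re) ∨ ∀ i, (τ (dV i)).re < 0)
    (Φ₁ Φ₂ : piSchwartzBruhat (↥(maximalRealSubfield L)) (Fin n')) :
    Continuous fun h : ↥(UnitaryGroup.adelic (↥(maximalRealSubfield L)) L (IsCMField.complexConj L) 1 (JW (↥(maximalRealSubfield L)) L a)) =>
      schwartzPairing (↥(maximalRealSubfield L)) (Fin n') ν
        (pairRep (↥(maximalRealSubfield L)) L (IsCMField.complexConj L) N 1 e₁ (Matrix.diagonal dV) (JW (↥(maximalRealSubfield L)) L a)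
          (chiSplittingLine L e₁ dV hdV hdV0 χ hχu hχs (TW (↥(maximalRealSubfield L)) a)
            (isUnit_det_TW (↥(maximalRealSubfield L)) a) (JW (↥(maximalRealSubfield L)) L a) (JW_eq (↥(maximalRealSubfield L)) L a)) (1, h) Φ₁) Φ₂ :=
  continuous_schwartzPairing_pairRep_line_one_of_signs L e₁ dV hdV hdV0 ν _ (complexConj_coe_realSubfield L a) (coe_realSubfield_ne_zero L a)
    (TW (↥(maximalRealSubfield L)) a) (TW_eq_realDiagonal L a) (isSymm_TW (↥(maximalRealSubfield L)) a) (isUnit_det_TW (↥(maximalRealSubfield L)) a)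
    (JW (↥(maximalRealSubfield L)) L a) (JW_eq (↥(maximalRealSubfield L)) L a)
    (isCompatible_chiSplittingLine L e₁ dV hdV hdV0 χ hχu hχs _ (isSymm_TW (↥(maximalRealSubfield L)) a) _ _ _)
    (continuous_chiSplittingLine L e₁ dV hdV hdV0 χ hχu hχs _ _ _ _) ι₁ h₁V hV Φ₁ Φ₂

set_option maxHeartbeats 1600000 in
/-- **the `hcoef` row of Rallis' letter for ★ `lineThetaKernelDatum L N e₁ dV hdV hdV0 μ hμ a hρ`** (`χ := toHeckeCharacter L μ`), from `(ι₁, h₁V, hV)`.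
[cite: Li1992, (25)–(26) p. 184] [cite: Liu2021, App. D §D.1 Steps 1–2 (l. 5215–5219)] -/
theorem continuous_schwartzPairing_lineThetaKernelDatum_one (μ : Literature.NumberTheory.Automorphic.IdeleClassGroup L →ₜ* Circle)
    (hμ : IsConjugateSymplectic L μ) (a : (↥(maximalRealSubfield L))ˣ) (ι₁ : L →+* ℂ)
    (h₁V : ∃ i₀ : Fin N, (∀ i, i ≠ i₀ → 0 < (ι₁ (dV i)).re) ∨ ∀ i, i ≠ i₀ → (ι₁ (dV i)).re < 0)
    (hV : ∀ τ : L →+* ℂ, InfinitePlace.mk τ ≠ InfinitePlace.mk ι₁ → (∀ i, 0 < (τ (dV i)).re) ∨ ∀ i, (τ (dV i)).re < 0)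
    (Φ₁ Φ₂ : piSchwartzBruhat (↥(maximalRealSubfield L)) (Fin n')) :
    Continuous fun h : ↥(UnitaryGroup.adelic (↥(maximalRealSubfield L)) L (IsCMField.complexConj L) 1 (JW (↥(maximalRealSubfield L)) L a)) =>
      schwartzPairing (↥(maximalRealSubfield L)) (Fin n') ν
        (pairRep (↥(maximalRealSubfield L)) L (IsCMField.complexConj L) N 1 e₁ (Matrix.diagonal dV) (JW (↥(maximalRealSubfield L)) L a)
          (chiSplittingLine L e₁ dV hdV hdV0 (toHeckeCharacter L μ) (isUnitary_toHeckeCharacter L μ)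
            ((isOscillatorChar_toHeckeCharacter_iff μ).mpr hμ) (TW (↥(maximalRealSubfield L)) a)
            (isUnit_det_TW (↥(maximalRealSubfield L)) a) (JW (↥(maximalRealSubfield L)) L a) (JW_eq (↥(maximalRealSubfield L)) L a)) (1, h) Φ₁) Φ₂ :=
  continuous_schwartzPairing_pairRep_chiSplittingLine_TW_one L e₁ dV hdV hdV0 ν (toHeckeCharacter L μ) (isUnitary_toHeckeCharacter L μ)
    ((isOscillatorChar_toHeckeCharacter_iff μ).mpr hμ) a ι₁ h₁V hV Φ₁ Φ₂

set_option maxHeartbeats 1600000 in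
/-- **`L²`-orbit continuity for the line datum, T5 spelling**: every `(u₁, u₂) ↦ i (ω(s_χ(u₁,u₂)) Φ)` is continuous in `L²(𝔸^{n'}, ν)` for
`s_χ := chiSplittingLine … (toHeckeCharacter L μ) … (T_W a) … (J_W a) …` and any class map `i`. [cite: Weil1964, Chap. III n° 41 Lemme 5 p. 194, n° 39 p. 189] -/
theorem continuous_toLp_pairRep_lineThetaKernelDatum (μ : Literature.NumberTheory.Automorphic.IdeleClassGroup L →ₜ* Circle)
    (hμ : IsConjugateSymplectic L μ) (a : (↥(maximalRealSubfield L))ˣ)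
    (i : piSchwartzBruhat (↥(maximalRealSubfield L)) (Fin n') →ₗ[ℂ] Lp ℂ 2 ν)
    (hi : ∀ Φ : piSchwartzBruhat (↥(maximalRealSubfield L)) (Fin n'),
      ((i Φ : Lp ℂ 2 ν) : (Fin n' → AdeleRing (𝓞 ↥(maximalRealSubfield L)) ↥(maximalRealSubfield L)) → ℂ) =ᵐ[ν]
        (Φ : (Fin n' → AdeleRing (𝓞 ↥(maximalRealSubfield L)) ↥(maximalRealSubfield L)) → ℂ))
    (ι₁ : L →+* ℂ)
    (h₁V : ∃ i₀ : Fin N, (∀ i, i ≠ i₀ → 0 < (ι₁ (dV i)).re) ∨ ∀ i, i ≠ i₀ → (ι₁ (dV i)).re < 0)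
    (hV : ∀ τ : L →+* ℂ, InfinitePlace.mk τ ≠ InfinitePlace.mk ι₁ → (∀ i, 0 < (τ (dV i)).re) ∨ ∀ i, (τ (dV i)).re < 0)
    (Φ : piSchwartzBruhat (↥(maximalRealSubfield L)) (Fin n')) :
    Continuous fun
      (p : ↥(UnitaryGroup.adelic (↥(maximalRealSubfield L)) L (IsCMField.complexConj L) N (Matrix.diagonal dV)) ×
        ↥(UnitaryGroup.adelic (↥(maximalRealSubfield L)) L (IsCMField.complexConj L) 1 (JW (↥(maximalRealSubfield L)) L a))) =>
      i (pairRep (↥(maximalRealSubfield L)) L (IsCMField.complexConj L) N 1 e₁ (Matrix.diagonal dV) (JW (↥(maximalRealSubfield L)) L a)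
          (chiSplittingLine L e₁ dV hdV hdV0 (toHeckeCharacter L μ) (isUnitary_toHeckeCharacter L μ)
            ((isOscillatorChar_toHeckeCharacter_iff μ).mpr hμ) (TW (↥(maximalRealSubfield L)) a)
            (isUnit_det_TW (↥(maximalRealSubfield L)) a) (JW (↥(maximalRealSubfield L)) L a) (JW_eq (↥(maximalRealSubfield L)) L a)) p Φ) :=
  continuous_toLp_pairRep_line_of_signs L e₁ dV hdV hdV0 ν _ (complexConj_coe_realSubfield L a) (coe_realSubfield_ne_zero L a)
    (TW (↥(maximalRealSubfield L)) a) (TW_eq_realDiagonal L a) (isSymm_TW (↥(maximalRealSubfield L)) a) (isUnit_det_TW (↥(maximalRealSubfield L)) a)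
    (JW (↥(maximalRealSubfield L)) L a) (JW_eq (↥(maximalRealSubfield L)) L a)
    (isCompatible_chiSplittingLine L e₁ dV hdV hdV0 _ _ _ _ (isSymm_TW (↥(maximalRealSubfield L)) a) _ _ _)
    (continuous_chiSplittingLine L e₁ dV hdV hdV0 _ _ _ _ _ _ _) i hi ι₁ h₁V hV Φ

end Literature.NumberTheory.Automorphic.Liu2021

end
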